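import Summits.QuantumFields.YangMills.Theorems.ColdStartUniversalityLatticeLangevinBakryEmeryPoincare
import Mathlib.Analysis.SpecialFunctions.SmoothTransition
import HarnessLib

/-!
# Route `ColdStartUniversality` (fixed-cut-off package, Bakry–Émery side, log-Sobolev half): DISSIPATION OF THE FISHER
# INFORMATION along the SZZ semigroup from the entropic curvature inequality

Helper file (seat `ym-line-csu-p1`, g26; `--supports stmt-QuantumFields-24809`).  For the SU(2) lattice Langevin dynamics of
Shen–Zhu–Zhu on `(ℤ/L)³` at a FIXED cut-off and coupling `β'`, `μ = μ_(β')` the Wilson measure, `𝓛 = 𝓛_(β')` the coordinate generator,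
`κ_t` any realising Markov kernel family.  HYPOTHESIS `hECD(c₀)` (entropic curvature, supplied by `…BakryEmeryEntropicCurvature` with
`c₀ = 2 − K₀` from a Hessian bound): for every `C³` `h`, `c₀·(−∫ 𝓛(e^h)·h dμ) ≤ ∫ 𝓛(e^h)·𝓛h dμ + ∫ (𝓛e^h)²/e^h dμ`.
★★ `fisher_dissipation_of_entropicCurvature` — for a positive `C³` compactly supported cylinder density `Q = q∘coords` and a `C³`
compactly supported ambient representative `G` of `𝓛q` (`G∘coords = 𝓛q`), at every time `τ`:
  `−∫ κ_τ(𝓛G)·log κ_τQ dμ − ∫ (κ_τ𝓛q)²/κ_τQ dμ ≤ c₀ · ∫ κ_τ(𝓛q)·log κ_τQ dμ`,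
i.e. `I'(τ) ≤ −c₀ I(τ)` for the Fisher information `I(τ) = −∫ κ_τ(𝓛q) log κ_τQ dμ = ∫ Γ(κ_τQ)/κ_τQ dμ` (its derivative is computed in the
sequel).  Proof: the Dynkin-class representative `g_τ` of `κ_τQ` (`transitionKernel_backwardKolmogorov`: `𝓛g_τ = κ_τ𝓛q`), a smooth
extension `φ` of `log` off `[δ, ∞)` (★ `exists_contDiff_eq_log_of_pos`, `δ = min Q > 0`), `h = φ∘g_τ`, locality of the generator
(★ `generator_congr_of_eventuallyEq`: `e^h = g_τ` near the range of `coords`), and the symmetry `integral_mul_generator_symm`.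
THEOREMS ONLY, no definition, no sorry.  HONEST FRAMING: fixed-cut-off semigroup calculus, conditional on `hECD`; nothing K-uniform;
no crux, rung or summit statement is proved; the Yang–Mills mass gap is NOT proved.
-/

set_option autoImplicit false

noncomputable section

namespace Summit.QuantumFields.YangMills.Theorems.ColdStartUniversality

open MeasureTheory ProbabilityTheory Finset Filter Set Metric
open scoped BigOperators NNReal ENNReal Topology
open Literature.Probability.Process Literature.MathematicalPhysics.QuantumFieldTheory
open Literature.MathematicalPhysics.QuantumLattice (fundamentalRep fundamentalLatticeRep continuous_fundamentalRep)

variable {L : ℕ} [NeZero L]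

/-! ## §1. Two small tools: a smooth extension of `log`, locality of the generator -/

/-- ★ **A `C^n` function on `ℝ` that agrees with `log` on `[a, ∞)`** (`a > 0`): `φ = log ∘ ψ` with
`ψ(x) = a/2 + (x − a/2)·smoothTransition((x − a/2)/(a/2)) ≥ a/2 > 0`, `ψ = id` on `[a, ∞)`. [folklore] -/
theorem exists_contDiff_eq_log_of_pos {a : ℝ} (ha : 0 < a) (n : ℕ) :
    ∃ φ : ℝ → ℝ, ContDiff ℝ n φ ∧ ∀ x, a ≤ x → φ x = Real.log x := by
  set ψ : ℝ → ℝ := fun x => a / 2 + (x - a / 2) * Real.smoothTransition ((x - a / 2) / (a / 2)) with hψ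
  have hψC : ContDiff ℝ n ψ := by
    refine contDiff_const.add ((contDiff_id.sub contDiff_const).mul ?_)
    exact Real.smoothTransition.contDiff.comp ((contDiff_id.sub contDiff_const).div_const _)
  have hψpos : ∀ x, 0 < ψ x := by
    intro x
    have h0 : 0 ≤ (x - a / 2) * Real.smoothTransition ((x - a / 2) / (a / 2)) := by
      by_cases hx : a / 2 ≤ x
      · exact mul_nonneg (sub_nonneg.2 hx) (Real.smoothTransition.nonneg _)
      · have hneg : (x - a / 2) / (a / 2) ≤ 0 :=
          div_nonpos_of_nonpos_of_nonneg (by linarith) (by linarith)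
        rw [Real.smoothTransition.zero_of_nonpos hneg, mul_zero]
    simp only [hψ]
    linarith
  have hψid : ∀ x, a ≤ x → ψ x = x := by
    intro x hx
    have h1 : 1 ≤ (x - a / 2) / (a / 2) := by
      rw [le_div_iff₀ (by linarith)]
      linarith
    simp only [hψ, Real.smoothTransition.one_of_one_le h1, mul_one]
    ring
  refine ⟨fun x => Real.log (ψ x), hψC.log fun x => (hψpos x).ne', fun x hx => ?_⟩
  simp only [hψid x hx]

/-- ★ **Locality of the coordinate generator**: two functions of the real link coordinates that agree near `coords x` have the same
generator at `x` (the generator only sees first and second derivatives at `coords x`). [folklore] -/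
theorem generator_congr_of_eventuallyEq (L : ℕ) [NeZero L] (β' : ℝ) {f₁ f₂ : (Edge 3 L × Fin 2 × Fin 2 × Bool → ℝ) → ℝ} (x : (GaugeConfig 3 L (Matrix.specialUnitaryGroup (Fin 2) ℂ)))
    (hfx : f₁ =ᶠ[𝓝 ((fun p : Edge 3 L × Fin 2 × Fin 2 × Bool => (fun z : ℂ => if p.2.2.2 then z.im else z.re) ((fundamentalRep (Fin 2) (x p.1) : Matrix (Fin 2) (Fin 2) ℂ) p.2.1 p.2.2.1)))] f₂) :
    let coords : GaugeConfig 3 L (Matrix.specialUnitaryGroup (Fin 2) ℂ) → (Edge 3 L × Fin 2 × Fin 2 × Bool → ℝ) :=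
      fun V q => (fun z : ℂ => if q.2.2.2 then z.im else z.re)
        ((fundamentalRep (Fin 2) (V q.1) : Matrix (Fin 2) (Fin 2) ℂ) q.2.1 q.2.2.1)
    let gen : ((Edge 3 L × Fin 2 × Fin 2 × Bool → ℝ) → ℝ) → GaugeConfig 3 L (Matrix.specialUnitaryGroup (Fin 2) ℂ) → ℝ :=
      fun h V =>
      (∑ i : Edge 3 L × Fin 2 × Fin 2 × Bool, fderiv ℝ h (coords V) (Pi.single i 1) *
          (fun z : ℂ => if i.2.2.2 then z.im else z.re)
            ((latticeLangevinDynamics (fundamentalLatticeRep 2) β').drift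
              (matrixConfig (fundamentalRep (Fin 2)) V) i.1 i.2.1 i.2.2.1) +
      1 / 2 * ∑ i : Edge 3 L × Fin 2 × Fin 2 × Bool, ∑ j : Edge 3 L × Fin 2 × Fin 2 × Bool,
        fderiv ℝ (fun z => fderiv ℝ h z (Pi.single i 1)) (coords V) (Pi.single j 1) *
          ∑ n : Edge 3 L × NoiseIdx 2,
            (if n.1 = i.1 then (fun z : ℂ => if i.2.2.2 then z.im else z.re)
              ((latticeLangevinDynamics (fundamentalLatticeRep 2) β').noise
                (matrixConfig (fundamentalRep (Fin 2)) V) i.1 n.2 i.2.1 i.2.2.1) else 0) *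
            (if n.1 = j.1 then (fun z : ℂ => if j.2.2.2 then z.im else z.re)
              ((latticeLangevinDynamics (fundamentalLatticeRep 2) β').noise
                (matrixConfig (fundamentalRep (Fin 2)) V) j.1 n.2 j.2.1 j.2.2.1) else 0))
    gen f₁ x = gen f₂ x := by
  intro coords gen
  have h1 : fderiv ℝ f₁ (coords x) = fderiv ℝ f₂ (coords x) := hfx.fderiv_eq
  have h2 : ∀ v : (Edge 3 L × Fin 2 × Fin 2 × Bool → ℝ), fderiv ℝ (fun z => fderiv ℝ f₁ z v) (coords x) = fderiv ℝ (fun z => fderiv ℝ f₂ z v) (coords x) := by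
    intro v
    refine Filter.EventuallyEq.fderiv_eq ?_
    exact (hfx.fderiv (𝕜 := ℝ)).mono fun z hz => by
      show fderiv ℝ f₁ z v = fderiv ℝ f₂ z v
      rw [hz]
  simp only [gen, h1, h2]

/-! ## §2. Dissipation of the Fisher information -/

/-- ★★ **Dissipation of the Fisher information along the SZZ semigroup, from the entropic curvature inequality.**  Under `hECD(c₀)`,
for any realising kernel family `κ`, any positive `C³` compactly supported cylinder density `Q = q∘coords`, any `C³` compactly supported
ambient representative `G` of `𝓛q` and every `τ ≥ 0`:
`−∫ κ_τ(𝓛G)·log κ_τQ dμ − ∫ (κ_τ𝓛q)²/κ_τQ dμ ≤ c₀ ∫ κ_τ(𝓛q)·log κ_τQ dμ`  (`I' ≤ −c₀ I`).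
[cite: BakryGentilLedoux2014, Prop. 5.7.3] -/
theorem fisher_dissipation_of_entropicCurvature (L : ℕ) [NeZero L] (β' c₀ : ℝ)
    (hECD : (∀ (h : (Edge 3 L × Fin 2 × Fin 2 × Bool → ℝ) → ℝ), ContDiff ℝ 3 h →
      let coords : GaugeConfig 3 L (Matrix.specialUnitaryGroup (Fin 2) ℂ) → (Edge 3 L × Fin 2 × Fin 2 × Bool → ℝ) :=
      fun V q => (fun z : ℂ => if q.2.2.2 then z.im else z.re)
        ((fundamentalRep (Fin 2) (V q.1) : Matrix (Fin 2) (Fin 2) ℂ) q.2.1 q.2.2.1)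
      let gen : ((Edge 3 L × Fin 2 × Fin 2 × Bool → ℝ) → ℝ) → GaugeConfig 3 L (Matrix.specialUnitaryGroup (Fin 2) ℂ) → ℝ :=
      fun h V =>
      (∑ i : Edge 3 L × Fin 2 × Fin 2 × Bool, fderiv ℝ h (coords V) (Pi.single i 1) *
          (fun z : ℂ => if i.2.2.2 then z.im else z.re)
            ((latticeLangevinDynamics (fundamentalLatticeRep 2) β').drift
              (matrixConfig (fundamentalRep (Fin 2)) V) i.1 i.2.1 i.2.2.1) +
      1 / 2 * ∑ i : Edge 3 L × Fin 2 × Fin 2 × Bool, ∑ j : Edge 3 L × Fin 2 × Fin 2 × Bool,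
        fderiv ℝ (fun z => fderiv ℝ h z (Pi.single i 1)) (coords V) (Pi.single j 1) *
          ∑ n : Edge 3 L × NoiseIdx 2,
            (if n.1 = i.1 then (fun z : ℂ => if i.2.2.2 then z.im else z.re)
              ((latticeLangevinDynamics (fundamentalLatticeRep 2) β').noise
                (matrixConfig (fundamentalRep (Fin 2)) V) i.1 n.2 i.2.1 i.2.2.1) else 0) *
            (if n.1 = j.1 then (fun z : ℂ => if j.2.2.2 then z.im else z.re)
              ((latticeLangevinDynamics (fundamentalLatticeRep 2) β').noise
                (matrixConfig (fundamentalRep (Fin 2)) V) j.1 n.2 j.2.1 j.2.2.1) else 0))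
      c₀ * (-∫ V, gen (fun z => Real.exp (h z)) V * h (coords V) ∂(wilsonMeasure (d := 3) (L := L) (fundamentalRep (Fin 2)) β')) ≤
        ∫ V, gen (fun z => Real.exp (h z)) V * gen h V ∂(wilsonMeasure (d := 3) (L := L) (fundamentalRep (Fin 2)) β') +
          ∫ V, (gen (fun z => Real.exp (h z)) V) ^ 2 / Real.exp (h (coords V)) ∂(wilsonMeasure (d := 3) (L := L) (fundamentalRep (Fin 2)) β')))
    (κ : ℝ≥0 → Kernel (GaugeConfig 3 L (Matrix.specialUnitaryGroup (Fin 2) ℂ))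
      (GaugeConfig 3 L (Matrix.specialUnitaryGroup (Fin 2) ℂ))) [∀ t, IsMarkovKernel (κ t)]
    (hreal : ∀ (t : ℝ≥0) (x : GaugeConfig 3 L (Matrix.specialUnitaryGroup (Fin 2) ℂ))
        (Ω : Type) [MeasurableSpace Ω] (P : Measure Ω) [IsProbabilityMeasure P]
        (W : ℝ≥0 → Ω → (Edge 3 L × NoiseIdx 2 → ℝ)) (hW : IsFlatBrownian W P)
        (U : ℝ≥0 → Ω → GaugeConfig 3 L (Matrix.specialUnitaryGroup (Fin 2) ℂ)),
        (∀ ω, U 0 ω = x) →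
        (latticeLangevinDynamics (fundamentalLatticeRep 2) β').IsSolution (fundamentalRep (Fin 2))
          hW.natFiltration P W U →
        κ t x = P.map (U t))
    {q : (Edge 3 L × Fin 2 × Fin 2 × Bool → ℝ) → ℝ} (hq : ContDiff ℝ 3 q) (hqc : HasCompactSupport q)
    {G : (Edge 3 L × Fin 2 × Fin 2 × Bool → ℝ) → ℝ} (hG : ContDiff ℝ 3 G) (hGc : HasCompactSupport G) (τ : ℝ≥0) :
    let coords : GaugeConfig 3 L (Matrix.specialUnitaryGroup (Fin 2) ℂ) → (Edge 3 L × Fin 2 × Fin 2 × Bool → ℝ) :=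
      fun V q => (fun z : ℂ => if q.2.2.2 then z.im else z.re)
        ((fundamentalRep (Fin 2) (V q.1) : Matrix (Fin 2) (Fin 2) ℂ) q.2.1 q.2.2.1)
    let gen : ((Edge 3 L × Fin 2 × Fin 2 × Bool → ℝ) → ℝ) → GaugeConfig 3 L (Matrix.specialUnitaryGroup (Fin 2) ℂ) → ℝ :=
      fun h V =>
      (∑ i : Edge 3 L × Fin 2 × Fin 2 × Bool, fderiv ℝ h (coords V) (Pi.single i 1) *
          (fun z : ℂ => if i.2.2.2 then z.im else z.re)
            ((latticeLangevinDynamics (fundamentalLatticeRep 2) β').drift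
              (matrixConfig (fundamentalRep (Fin 2)) V) i.1 i.2.1 i.2.2.1) +
      1 / 2 * ∑ i : Edge 3 L × Fin 2 × Fin 2 × Bool, ∑ j : Edge 3 L × Fin 2 × Fin 2 × Bool,
        fderiv ℝ (fun z => fderiv ℝ h z (Pi.single i 1)) (coords V) (Pi.single j 1) *
          ∑ n : Edge 3 L × NoiseIdx 2,
            (if n.1 = i.1 then (fun z : ℂ => if i.2.2.2 then z.im else z.re)
              ((latticeLangevinDynamics (fundamentalLatticeRep 2) β').noise
                (matrixConfig (fundamentalRep (Fin 2)) V) i.1 n.2 i.2.1 i.2.2.1) else 0) *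
            (if n.1 = j.1 then (fun z : ℂ => if j.2.2.2 then z.im else z.re)
              ((latticeLangevinDynamics (fundamentalLatticeRep 2) β').noise
                (matrixConfig (fundamentalRep (Fin 2)) V) j.1 n.2 j.2.1 j.2.2.1) else 0))
    (∀ x, 0 < q (coords x)) → (∀ x, G (coords x) = gen q x) →
    -∫ x, (∫ y, gen G y ∂(κ τ x)) * Real.log (∫ y, q (coords y) ∂(κ τ x)) ∂(wilsonMeasure (d := 3) (L := L) (fundamentalRep (Fin 2)) β') -
        ∫ x, (∫ y, gen q y ∂(κ τ x)) ^ 2 / (∫ y, q (coords y) ∂(κ τ x)) ∂(wilsonMeasure (d := 3) (L := L) (fundamentalRep (Fin 2)) β') ≤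
      c₀ * ∫ x, (∫ y, gen q y ∂(κ τ x)) * Real.log (∫ y, q (coords y) ∂(κ τ x)) ∂(wilsonMeasure (d := 3) (L := L) (fundamentalRep (Fin 2)) β') := by
  intro coords gen hpos hGq
  classical
  haveI := secondCountableTopology_su2
  haveI := borelSpace_config L
  set μ : Measure (GaugeConfig 3 L (Matrix.specialUnitaryGroup (Fin 2) ℂ)) := (wilsonMeasure (d := 3) (L := L) (fundamentalRep (Fin 2)) β') with hμ
  haveI : IsProbabilityMeasure μ :=
    isProbabilityMeasure_wilsonMeasure (d := 3) (L := L) (fundamentalRep (Fin 2)) (continuous_fundamentalRep (Fin 2)) β'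
  have hco : Continuous coords := continuous_coords (L := L)
  have hQc : Continuous fun V => q (coords V) := hq.continuous.comp hco
  -- a positive lower bound for `Q`
  obtain ⟨δ, hδ, hQδ⟩ : ∃ δ : ℝ, 0 < δ ∧ ∀ x : (GaugeConfig 3 L (Matrix.specialUnitaryGroup (Fin 2) ℂ)), δ ≤ q (coords x) := by
    obtain ⟨x₀, -, hx₀⟩ := isCompact_univ.exists_isMinOn (Set.univ_nonempty) hQc.continuousOn
    exact ⟨q (coords x₀), hpos x₀, fun x => hx₀ (Set.mem_univ x)⟩
  -- the Dynkin-class representatives of `κ_τ Q` and `κ_τ (G∘coords)`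
  obtain ⟨g, hg, hgc, hgF, hcomm, -⟩ := transitionKernel_backwardKolmogorov (L := L) β' κ hreal hq hqc τ
  obtain ⟨Gt, hGt, hGtc, hGtF, hGcomm, -⟩ := transitionKernel_backwardKolmogorov (L := L) β' κ hreal hG hGc τ
  have hgF' : ∀ x : (GaugeConfig 3 L (Matrix.specialUnitaryGroup (Fin 2) ℂ)), ∫ y, q (coords y) ∂(κ τ x) = g (coords x) := fun x => hgF x
  have hcomm' : ∀ x : (GaugeConfig 3 L (Matrix.specialUnitaryGroup (Fin 2) ℂ)), gen g x = ∫ y, gen q y ∂(κ τ x) := fun x => hcomm x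
  have hGtF' : ∀ x : (GaugeConfig 3 L (Matrix.specialUnitaryGroup (Fin 2) ℂ)), ∫ y, G (coords y) ∂(κ τ x) = Gt (coords x) := fun x => hGtF x
  have hGcomm' : ∀ x : (GaugeConfig 3 L (Matrix.specialUnitaryGroup (Fin 2) ℂ)), gen Gt x = ∫ y, gen G y ∂(κ τ x) := fun x => hGcomm x
  have hGt_eq : ∀ x : (GaugeConfig 3 L (Matrix.specialUnitaryGroup (Fin 2) ℂ)), Gt (coords x) = gen g x := by
    intro x
    rw [← hGtF' x, hcomm' x]
    exact integral_congr_ae (ae_of_all _ fun y => hGq y)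
  -- `g ≥ δ` on the range of the coordinates
  have hgδ : ∀ x : (GaugeConfig 3 L (Matrix.specialUnitaryGroup (Fin 2) ℂ)), δ ≤ g (coords x) := by
    intro x
    rw [← hgF' x]
    haveI : IsProbabilityMeasure (κ τ x) := IsMarkovKernel.isProbabilityMeasure x
    calc δ = ∫ _y, δ ∂(κ τ x) := by simp
      _ ≤ ∫ y, q (coords y) ∂(κ τ x) :=
          integral_mono (integrable_const _) (integrable_of_continuous_of_compactSpace hQc _) fun y => hQδ y
  have hgpos : ∀ x : (GaugeConfig 3 L (Matrix.specialUnitaryGroup (Fin 2) ℂ)), 0 < g (coords x) := fun x => hδ.trans_le (hgδ x)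
  -- the smooth logarithm and `h = φ ∘ g`
  obtain ⟨φ, hφ, hφlog⟩ := exists_contDiff_eq_log_of_pos (a := δ / 2) (by linarith) 3
  set h : (Edge 3 L × Fin 2 × Fin 2 × Bool → ℝ) → ℝ := fun z => φ (g z) with hh_def
  have hh : ContDiff ℝ 3 h := hφ.comp hg
  -- near the range of `coords`, `e^h = g`
  have hopen : IsOpen {z : (Edge 3 L × Fin 2 × Fin 2 × Bool → ℝ) | δ / 2 < g z} := isOpen_lt continuous_const hg.continuous
  have hmem : ∀ x : (GaugeConfig 3 L (Matrix.specialUnitaryGroup (Fin 2) ℂ)), coords x ∈ {z : (Edge 3 L × Fin 2 × Fin 2 × Bool → ℝ) | δ / 2 < g z} := fun x => by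
    show δ / 2 < g (coords x)
    linarith [hgδ x]
  have hexp_ev : ∀ x : (GaugeConfig 3 L (Matrix.specialUnitaryGroup (Fin 2) ℂ)), (fun z => Real.exp (h z)) =ᶠ[𝓝 (coords x)] g := by
    intro x
    filter_upwards [hopen.mem_nhds (hmem x)] with z hz
    have hz' : δ / 2 < g z := hz
    simp only [hh_def, hφlog (g z) hz'.le, Real.exp_log (by linarith : 0 < g z)]
  have hgen_exp : ∀ x : (GaugeConfig 3 L (Matrix.specialUnitaryGroup (Fin 2) ℂ)), gen (fun z => Real.exp (h z)) x = gen g x :=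
    fun x => generator_congr_of_eventuallyEq L β' x (hexp_ev x)
  have hh_val : ∀ x : (GaugeConfig 3 L (Matrix.specialUnitaryGroup (Fin 2) ℂ)), h (coords x) = Real.log (g (coords x)) := fun x => by
    simp only [hh_def, hφlog (g (coords x)) (by linarith [hgδ x])]
  have hexp_val : ∀ x : (GaugeConfig 3 L (Matrix.specialUnitaryGroup (Fin 2) ℂ)), Real.exp (h (coords x)) = g (coords x) := fun x => by
    rw [hh_val x, Real.exp_log (hgpos x)]
  -- a compactly supported copy of `h` for the symmetry identity
  let χ : ContDiffBump (0 : (Edge 3 L × Fin 2 × Fin 2 × Bool → ℝ)) := ⟨2, 3, by norm_num, by norm_num⟩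
  set h₁ : (Edge 3 L × Fin 2 × Fin 2 × Bool → ℝ) → ℝ := fun y => (χ : (Edge 3 L × Fin 2 × Fin 2 × Bool → ℝ) → ℝ) y * h y with hh₁def
  have hh₁ : ContDiff ℝ 3 h₁ := χ.contDiff.mul hh
  have hh₁c : HasCompactSupport h₁ := χ.hasCompactSupport.mul_right
  have hball : ∀ V : (GaugeConfig 3 L (Matrix.specialUnitaryGroup (Fin 2) ℂ)), coords V ∈ ball (0 : (Edge 3 L × Fin 2 × Fin 2 × Bool → ℝ)) 2 := by
    intro V
    rw [mem_ball, dist_zero_right]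
    exact (norm_coords_le_one V).trans_lt (by norm_num)
  have hh₁ev : ∀ x : (GaugeConfig 3 L (Matrix.specialUnitaryGroup (Fin 2) ℂ)), h₁ =ᶠ[𝓝 (coords x)] h := by
    intro x
    filter_upwards [isOpen_ball.mem_nhds (hball x)] with z hz
    have h1 : (χ : (Edge 3 L × Fin 2 × Fin 2 × Bool → ℝ) → ℝ) z = 1 := χ.one_of_mem_closedBall (ball_subset_closedBall hz)
    simp only [hh₁def, h1, one_mul]
  have hgen_h₁ : ∀ x : (GaugeConfig 3 L (Matrix.specialUnitaryGroup (Fin 2) ℂ)), gen h₁ x = gen h x := fun x => generator_congr_of_eventuallyEq L β' x (hh₁ev x)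
  have hh₁_val : ∀ x : (GaugeConfig 3 L (Matrix.specialUnitaryGroup (Fin 2) ℂ)), h₁ (coords x) = h (coords x) := fun x => (hh₁ev x).self_of_nhds
  -- symmetry: `∫ (𝓛Gt)·h dμ = ∫ Gt·𝓛h dμ`
  have hsymm : ∫ x, Gt (coords x) * gen h₁ x ∂μ = ∫ x, h₁ (coords x) * gen Gt x ∂μ :=
    integral_mul_generator_symm L β' hh₁ hh₁c hGt hGtc
  -- the three integrals of `hECD h`, read on the semigroup
  have hE : c₀ * (-∫ x, gen (fun z => Real.exp (h z)) x * h (coords x) ∂μ) ≤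
      ∫ x, gen (fun z => Real.exp (h z)) x * gen h x ∂μ +
        ∫ x, (gen (fun z => Real.exp (h z)) x) ^ 2 / Real.exp (h (coords x)) ∂μ := hECD h hh
  have e0 : ∫ x, gen (fun z => Real.exp (h z)) x * h (coords x) ∂μ =
      ∫ x, (∫ y, gen q y ∂(κ τ x)) * Real.log (∫ y, q (coords y) ∂(κ τ x)) ∂μ :=
    integral_congr_ae (ae_of_all _ fun x => by beta_reduce; rw [hgen_exp x, hcomm' x, hh_val x, hgF' x])
  have e1 : ∫ x, gen (fun z => Real.exp (h z)) x * gen h x ∂μ =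
      ∫ x, (∫ y, gen G y ∂(κ τ x)) * Real.log (∫ y, q (coords y) ∂(κ τ x)) ∂μ := by
    calc ∫ x, gen (fun z => Real.exp (h z)) x * gen h x ∂μ = ∫ x, Gt (coords x) * gen h₁ x ∂μ :=
          integral_congr_ae (ae_of_all _ fun x => by beta_reduce; rw [hgen_exp x, hgen_h₁ x, hGt_eq x])
      _ = ∫ x, h₁ (coords x) * gen Gt x ∂μ := hsymm
      _ = ∫ x, (∫ y, gen G y ∂(κ τ x)) * Real.log (∫ y, q (coords y) ∂(κ τ x)) ∂μ :=
          integral_congr_ae (ae_of_all _ fun x => by beta_reduce; rw [hh₁_val x, hGcomm' x, hh_val x, hgF' x, mul_comm])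
  have e2 : ∫ x, (gen (fun z => Real.exp (h z)) x) ^ 2 / Real.exp (h (coords x)) ∂μ =
      ∫ x, (∫ y, gen q y ∂(κ τ x)) ^ 2 / (∫ y, q (coords y) ∂(κ τ x)) ∂μ :=
    integral_congr_ae (ae_of_all _ fun x => by beta_reduce; rw [hgen_exp x, hcomm' x, hexp_val x, hgF' x])
  rw [e0, e1, e2] at hE
  linarith

end Summit.QuantumFields.YangMills.Theorems.ColdStartUniversality
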